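import Mathlib

/-!
# Filtered rank lemma (crux `ValuativeGCT.ValuativeFlip`, stub `stub_fourRowPencilRank`)

P3/P5 tool of the cyclic-tridiagonal architecture for hypothesis `H` of
`fourRowPencilRank_of_pencilCertificate` (`Cruxes/ValuativeFlip/AxisK9G1a2CyclicTridiagonal.md` §4):
a chain of subspaces `W a, W (a+1), …, W (a+k-1)` of a vector space `V` and linear maps
`π d : V → V'` such that `π d` KILLS every later member `W d'`, `d < d'` (think: `π d` = the
weighted-homogeneous component of weight `d`, `W d'` spanned by polynomials whose components of
weight `< d'` vanish).  Then

  `∑_{i<k} finrank (π (a+i)) (W (a+i)) ≤ finrank (W a ⊔ W (a+1) ⊔ ⋯ ⊔ W (a+k-1))`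

(`fr_sum_finrank_map_le`), by rank–nullity for `π a` restricted to the sup: its range contains
`π a (W a)` and its kernel contains the sup of the later members (`fr_finrank_sup_ge`).
The sup is the recursively defined `frY W a k = W a ⊔ frY W (a+1) (k-1)` (`frY_le` bounds it by any
common upper bound). [folklore linear algebra]
-/

set_option linter.dupNamespace false

namespace Summit.ValiantsHypothesis.ValiantsHypothesis.Theorems.ValuativeFlip

open Module

section filtered

variable {K V V' : Type*} [Field K] [AddCommGroup V] [Module K V] [AddCommGroup V'] [Module K V']

/-- The partial sups `frY W a k = W a ⊔ W (a+1) ⊔ ⋯ ⊔ W (a+k-1)` (recursive in `k`). [folklore] -/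
def frY (W : ℕ → Submodule K V) : ℕ → ℕ → Submodule K V
  | _, 0 => ⊥
  | a, k + 1 => W a ⊔ frY W (a + 1) k

/-- `frY W a 0 = ⊥`. -/
@[simp] theorem frY_zero (W : ℕ → Submodule K V) (a : ℕ) : frY W a 0 = ⊥ := rfl

/-- `frY W a (k+1) = W a ⊔ frY W (a+1) k`. -/
theorem frY_succ (W : ℕ → Submodule K V) (a k : ℕ) : frY W a (k + 1) = W a ⊔ frY W (a + 1) k := rfl

/-- A common upper bound of the members bounds the partial sup. [folklore] -/
theorem frY_le (W : ℕ → Submodule K V) {T : Submodule K V} :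
    ∀ (k a : ℕ), (∀ d, a ≤ d → d < a + k → W d ≤ T) → frY W a k ≤ T := by
  intro k
  induction k with
  | zero => intro a _; simp
  | succ k ih =>
    intro a h
    rw [frY_succ]
    exact sup_le (h a le_rfl (by omega)) (ih (a + 1) fun d h1 h2 => h d (by omega) (by omega))

/-- The partial sups are finite-dimensional when the members are. -/
instance frY_finiteDimensional (W : ℕ → Submodule K V) [hW : ∀ d, FiniteDimensional K (W d)] :
    ∀ (k a : ℕ), FiniteDimensional K (frY W a k)
  | 0, a => by rw [frY_zero]; infer_instance
  | k + 1, a => by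
    rw [frY_succ]
    haveI := frY_finiteDimensional W k (a + 1)
    exact Submodule.finiteDimensional_sup _ _

/-- **Rank–nullity step.**  If `B ≤ ker π` then `finrank (π '' A) + finrank B ≤ finrank (A ⊔ B)`
(`A`, `B` finite-dimensional). [folklore] -/
theorem fr_finrank_sup_ge (π : V →ₗ[K] V') (A B : Submodule K V) [FiniteDimensional K A]
    [FiniteDimensional K B] (hB : B ≤ LinearMap.ker π) :
    finrank K (A.map π) + finrank K B ≤ finrank K ↥(A ⊔ B) := by
  haveI : FiniteDimensional K ↥(A ⊔ B) := Submodule.finiteDimensional_sup A B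
  set φ : ↥(A ⊔ B) →ₗ[K] V' := π.domRestrict (A ⊔ B) with hφ
  have hrn := LinearMap.finrank_range_add_finrank_ker φ
  have h1 : finrank K (A.map π) ≤ finrank K (LinearMap.range φ) := by
    apply Submodule.finrank_mono
    rw [hφ, LinearMap.range_domRestrict]
    exact Submodule.map_mono le_sup_left
  have h2 : finrank K B ≤ finrank K (LinearMap.ker φ) := by
    have hBle : B ≤ A ⊔ B := le_sup_right
    rw [← LinearEquiv.finrank_eq (Submodule.comapSubtypeEquivOfLe hBle)]
    apply Submodule.finrank_mono
    intro x hx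
    rw [LinearMap.mem_ker, hφ, LinearMap.domRestrict_apply]
    exact hB hx
  omega

/-- **Filtered rank lemma.**  If every `π d` kills every later member `W d'` (`d < d'`), then
`∑_{i<k} finrank (π (a+i) '' W (a+i)) ≤ finrank (frY W a k)`. [folklore] -/
theorem fr_sum_finrank_map_le (W : ℕ → Submodule K V) (π : ℕ → V →ₗ[K] V')
    [hW : ∀ d, FiniteDimensional K (W d)]
    (hkill : ∀ d d', d < d' → W d' ≤ LinearMap.ker (π d)) :
    ∀ (k a : ℕ), ∑ i ∈ Finset.range k, finrank K ((W (a + i)).map (π (a + i))) ≤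
      finrank K (frY W a k) := by
  intro k
  induction k with
  | zero => intro a; simp
  | succ k ih =>
    intro a
    rw [Finset.sum_range_succ', frY_succ]
    simp only [Nat.add_zero]
    have hker : frY W (a + 1) k ≤ LinearMap.ker (π a) :=
      frY_le W k (a + 1) fun d h1 _ => hkill a d (by omega)
    haveI := frY_finiteDimensional W k (a + 1)
    have hstep := fr_finrank_sup_ge (π a) (W a) (frY W (a + 1) k) hker
    have ih' := ih (a + 1)
    have hre : ∑ i ∈ Finset.range k, finrank K ((W (a + (i + 1))).map (π (a + (i + 1)))) =
        ∑ i ∈ Finset.range k, finrank K ((W (a + 1 + i)).map (π (a + 1 + i))) := by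
      refine Finset.sum_congr rfl fun i _ => ?_
      rw [show a + (i + 1) = a + 1 + i by ring]
    rw [hre]
    omega

end filtered

end Summit.ValiantsHypothesis.ValiantsHypothesis.Theorems.ValuativeFlip
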